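import Summits.BirchSwinnertonDyer.Rank1Residual.X11b.Three.KolyvaginClassBadPlace
import Summits.BirchSwinnertonDyer.Rank1Residual.X11b.Three.KolyvaginRootIntegrality
import HarnessLib

/-!
# X11b at `p = 3` (team N8/O2), JET3-KUMMER (b) values half, END FORM: Gross 1991 Prop. 6.2 (1) at
# a bad place for Kolyvagin's point `P_n`, the binder [GZ86, III (3.1)] carried as ONE hypothesis

HONEST FRAMING (cell `b2b-bsdres`, run/shared/lean/b2b/bsd-rank1-residual/, verbatim in every
file): the goal of the cell is to DELETE the COMBINATION-SHAPED residual classes of the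
Birch–Swinnerton-Dyer formula for ALL analytic-rank `≤ 1` elliptic curves over `ℚ` — "full BSD
formula for every rank `≤ 1` curve in class `C`" assembled STRICTLY from published theorems — so
that the rank-`≤ 1` remainder becomes exactly the CONSTRUCTION-SHAPED classes, which are TYPED
(missing-input `Prop`s), NOT attempted. This is not "finishing BSD". Team N8/O2 = `x11b3`, seat
`b2b-bsdres-x11b3-p1`, LEAD DEAL #6 (R6-8): "discharge `hval` of
`KolyvaginClassBadPlace.…_of_mem_of_zsmul_mem` from `KolyvaginRoot.rootIn_smul_sub_mem` with
`E′ = ⋂_{w∣v} (E⁰(K_{n,w}) + E(ℚ)_tors)` [GZ86 III (3.1) via Gross 1991 p. 245, lit1 L38] carried as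
ONE labelled binder `hGZ31` (NO new fact)". LABEL OF RECORD: flag-discharge work (`JET@p|N`) —
kernel hygiene for the Jetchev road, NOT count-moving at 3 this cycle. THEOREMS ONLY: no
definition, no named fact, no `sorry`; nothing is booked; the flag is NOT discharged here.

## What

Gross 1991, Prop. 6.2 (1) at `v ∣ N` (pp. 244–245), for the point Kolyvagin actually uses,
`P_n = Σ_{s∈S} s D_n y_n` (tree `KolyvaginEuler.kolyvaginPoint`), assembled from the chain's files:

* §1 `exists_mem_map_zsmul_eq_smul_sub_of_equivariant`, `rootIn_smul_sub_mem_map_of_equivariant` —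
  transport of the integrality `γP_n − P_n ∈ p^M E′` (`KolyvaginRoot.smul_kolyvaginPoint_sub_mem_map`,
  p253535) along an equivariant `j : E(K_n) → E(K̄)` over `π : Γ_K → 𝒢_n` (the tree's
  `KolyvaginEuler.exists_zsmul_eq_smul_sub_of_equivariant` pattern): McCallum's root
  `rootIn (j E(K_n)) p^M ((g−1) jP_n)` lies in `j(E′)` for every `g ∈ Γ_K`.
* §2 **`kolyvaginClass_kolyvaginPoint_mem_selmerLocalKer_of_GZ31`** — the END FORM: for `E` over
  a number field `K`, a finite place `v ∤ n` (bad places included), Kolyvagin's class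
  `c(jP_n) ∈ H¹(K, E[p^M])` satisfies the Selmer local condition at `v`
  (`∈ selmerLocalKer W K_v p^M`) from
  - the Euler-system data of the tree's Prop. 3.6 / (4.1) (`σ_ℓ` generating `G_n`,
    `σ_ℓ^{ℓ+1} = 1`, `p^M ∣ ℓ+1`) and the standing inputs of McCallum's cocycle (`j` equivariant,
    `j(E(K_n))` admissible = Gross Lemma 4.3 "`E(K_n)[p] = 0`", inertia at `v` fixes `jP_n` =
    "`K_n/K` unramified at `v ∤ n`");
  - **`hGZ31`, ONE labelled binder** (PUBLISHED input [GZ86, III (3.1)] as used by Gross 1991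
    p. 245; cite-only, lit1 L38; NOT a claim, NOT a new fact): a `𝒢_n`-stable subgroup `E′ ≤ E(K_n)`
    containing `y_n`, with `Tr_ℓ y_n ∈ p^M E′` for `ℓ ∣ n` (⇐ Prop. 3.7 (1) `Tr_ℓ y_n = a_ℓ y_{n/ℓ}`,
    `y_{n/ℓ} ∈ E′`, `p^M ∣ a_ℓ` — `KolyvaginRoot.grAct_traceElt_mem_map_of_eq_smul`), whose image at
    `v` is killed INTO `B = E⁰(K_v^{un})` by an integer `n′` prime to `p` ("`E′ = E⁰ + E(ℚ)_tors`
    at every `w ∣ v`", `n′ = #E(ℚ)_tors`, `E(ℚ)[p] = 0`);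
  - (α) for `B`: `B`-valued continuous cocycles of `Γ_{K_v}` vanishing on inertia have trivial
    class (Milne *ADT* I.3.8 for `E⁰`, lit1 L51; p4's h1ker/h1red).
  The values hypothesis `hval` of `KolyvaginClassBadPlace` is DISCHARGED (from §1); what is
  carried is exactly `hGZ31` + (α) + the Euler-system data.

References (locators only; no cited FACT): [cite: GrossLMS1991, Prop. 3.6, §4 (4.1), Prop. 6.2 (1)
pp. 244–245] [cite: GrossZagier1986, III (3.1)] [cite: McCallumLMS1991, §4 (4)–(5), Lemma 4.1,
Lemma 4.3] [cite: MilneADT2006, Ch. I Prop. 3.8]; cell files p253373, p253535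
(HOME/b2b-bsdres-x11b3-p1/JET3-KUMMER-CHAIN.md).
-/

noncomputable section

open scoped Classical
open scoped AddSubgroup

namespace Summit.BirchSwinnertonDyer.Rank1Residual.X11b.Three.GrossBadPlace

open WeierstrassCurve NumberField IsDedekindDomain Field
  Literature.NumberTheory.EllipticCurves Literature.NumberTheory.EllipticCurves.KolyvaginCocycle
  Literature.NumberTheory.EllipticCurves.KolyvaginEuler Literature.NumberTheory.GaloisRepresentations
  Summit.BirchSwinnertonDyer.Rank1Residual.X11b.Three.KolyvaginRoot

universe u

/-! ### §1 Transport of the integrality along `j : E(K_n) → E(K̄)` -/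

section Transport

variable {𝒢 : Type*} [CommGroup 𝒢] {A₀ : Type*} [AddCommGroup A₀] [DistribMulAction 𝒢 A₀]
variable {Γ : Type*} [Group Γ] {X : Type*} [AddCommGroup X] [DistribMulAction Γ X]

/-- **Transport of "`γP − P ∈ nE′`" along an equivariant map** (the tree's
`exists_zsmul_eq_smul_sub_of_equivariant` inside `E′`): if `γP − P ∈ nE′` for all `γ ∈ 𝒢`
(`E′ ≤ A₀`, printed `E(K_n) ⊇ E′`), then for every `g ∈ Γ` there is `R ∈ j(E′)` with
`nR = g·jP − jP`. [cite: McCallumLMS1991, §4 (4), Lemma 4.1] -/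
theorem exists_mem_map_zsmul_eq_smul_sub_of_equivariant (π : Γ →* 𝒢) (j : A₀ →+ X)
    (hj : ∀ (g : Γ) (a : A₀), j (π g • a) = g • j a) {n : ℤ} {E' : AddSubgroup A₀} {P : A₀}
    (hP : ∀ γ : 𝒢, γ • P - P ∈ E'.map (zsmulAddGroupHom n : A₀ →+ A₀)) (g : Γ) :
    ∃ R ∈ E'.map j, n • R = g • j P - j P := by
  obtain ⟨a, ha, hna⟩ := hP (π g)
  refine ⟨j a, ⟨a, ha, rfl⟩, ?_⟩
  rw [← map_zsmul, show n • a = π g • P - P from hna, map_sub, hj]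

/-- **McCallum's root lies in `j(E′)`**: with `A = j(E(K_n))` admissible, the root
`rootIn A n (g·jP − jP)` chosen by McCallum's cocycle belongs to `j(E′)` whenever
`γP − P ∈ nE′` for all `γ ∈ 𝒢` (uniqueness of roots, `KolyvaginRoot.rootIn_mem_of_exists`).
[cite: McCallumLMS1991, §4 (5), Lemma 4.1] [cite: GrossLMS1991, Prop. 6.2 (proof, p. 245)] -/
theorem rootIn_smul_sub_mem_map_of_equivariant (π : Γ →* 𝒢) (j : A₀ →+ X)
    (hj : ∀ (g : Γ) (a : A₀), j (π g • a) = g • j a) {n : ℤ}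
    (hA : IsAdmissible Γ j.range n) {E' : AddSubgroup A₀} {P : A₀}
    (hP : ∀ γ : 𝒢, γ • P - P ∈ E'.map (zsmulAddGroupHom n : A₀ →+ A₀)) (g : Γ) :
    rootIn j.range n (g • j P - j P) ∈ E'.map j := by
  obtain ⟨R, hR, hnR⟩ := exists_mem_map_zsmul_eq_smul_sub_of_equivariant π j hj hP g
  obtain ⟨a, ha, rfl⟩ := hR
  exact rootIn_mem_of_exists hA ⟨j a, ⟨a, ha, rfl⟩, ⟨a, rfl⟩, hnR⟩

end Transport

/-! ### §2 The END FORM: Prop. 6.2 (1) at a bad place for `P_n`, with the binder `hGZ31` -/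

section End

variable {K : Type u} [Field K] [NumberField K] (W : WeierstrassCurve K) {n : ℤ}
variable {hdiv : ∀ P : geomPoints W, ∃ Q : geomPoints W, n • Q = P}
variable {𝒢 : Type*} [CommGroup 𝒢] {A₀ : Type*} [AddCommGroup A₀] [DistribMulAction 𝒢 A₀]

/-- **Gross 1991, Prop. 6.2 (1) at a finite place `v ∤ n` — bad places included — for Kolyvagin's
point `P_n = Σ_{s∈S} s D_n y_n`, END FORM.** Setting (the tree's, `KolyvaginEuler` +
`KolyvaginCocycle`): `𝒢 = 𝒢_n = Gal(K_n/K)` acting on `A₀ = E(K_n)`; `σ_ℓ` (`ℓ ∈ L`, the primes of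
`n`) generate `G_n = H`, `σ_ℓ^{ℓ+1} = 1`, `n = p^M ∣ ℓ+1`; `f` a section of `𝒢 → 𝒢/G_n`;
`j : E(K_n) → E(K̄)` additive and equivariant over `π : Γ_K → 𝒢`, with `j(E(K_n))` admissible
(Gross Lemma 4.3); `c(jP_n)` McCallum's class; `v` a finite place, `I_𝔐` its inertia in
`Γ_{K_v}`, fixing `jP_n` (`K_n/K` unramified at `v ∤ n`). INPUTS CARRIED: **`hGZ31`** — the
PUBLISHED input [GZ86, III (3.1)] as used in Gross 1991 p. 245 ("`y_n` is, up to translation by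
rational torsion on `E`, in `E⁰`"; cite-only, lit1 L38) in the shape the kernel consumes: a `𝒢`-stable
`E′ ≤ E(K_n)` with `y_n ∈ E′`, `Tr_ℓ y_n ∈ p^M E′` (`ℓ ∈ L`; from Prop. 3.7 (1) and `y_{n/ℓ} ∈ E′`),
and `n′ • (jx)_v ∈ B` for `x ∈ E′` with `n′` prime to `p^M` (`B = E⁰(K_v^{un}) ≤ E(K̄_v)`,
`n′ = #E(ℚ)_tors`); and **(α)** for `B` (Milne *ADT* I.3.8 for `E⁰`). CONCLUSION:
`c(jP_n) ∈ selmerLocalKer W K_v p^M` ("`d(n)_v = 0`"). The values hypothesis of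
`kolyvaginClass_mem_selmerLocalKer_of_inertia_of_mem_of_zsmul_mem` is discharged by the
integrality of Kolyvagin's roots (`KolyvaginRoot.smul_kolyvaginPoint_sub_mem_map`) transported
along `j` (§1). [cite: GrossLMS1991, Prop. 6.2 (1), pp. 244–245] [cite: GrossZagier1986, III (3.1)]
[cite: McCallumLMS1991, Lemma 4.3] [cite: MilneADT2006, Ch. I Prop. 3.8] -/
theorem kolyvaginClass_kolyvaginPoint_mem_selmerLocalKer_of_GZ31
    -- the Euler-system data (Gross §3, (4.1))
    {σ : ℕ → 𝒢} {L : Finset ℕ} {H : Subgroup 𝒢} [Fintype (𝒢 ⧸ H)] {f : 𝒢 ⧸ H → 𝒢}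
    (hf : ∀ q, (f q : 𝒢 ⧸ H) = q) (hgen : H ≤ Subgroup.closure (σ '' (L : Set ℕ)))
    (hord : ∀ ℓ ∈ L, σ ℓ ^ (ℓ + 1) = 1) (hdvd : ∀ ℓ ∈ L, n ∣ ((ℓ + 1 : ℕ) : ℤ)) {y : A₀}
    -- `E(K_n) → E(K̄)` over `Γ_K → 𝒢_n`, admissible image (Gross Lemma 4.3)
    (π : absoluteGaloisGroup K →* 𝒢) (j : A₀ →+ geomPoints W)
    (hj : ∀ (g : absoluteGaloisGroup K) (a : A₀), j (π g • a) = g • j a)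
    (hA : IsAdmissible (absoluteGaloisGroup K) j.range n)
    (hP : j (kolyvaginPoint σ L f y) ∈ invPoints (absoluteGaloisGroup K) j.range n)
    -- the place
    (v : HeightOneSpectrum (𝓞 K)) {𝔐 : Ideal (v.localAbsIntegers)}
    (hI : ∀ τ ∈ 𝔐.inertia (absoluteGaloisGroup (v.adicCompletion K)),
      resGal (K := K) (v.adicCompletion K) τ • j (kolyvaginPoint σ L f y) =
        j (kolyvaginPoint σ L f y))
    -- hGZ31 (= [GZ86, III (3.1)] via Gross 1991 p. 245; cite-only) + (α)
    {E' : AddSubgroup A₀} (B : AddSubgroup (localPoints W (v.adicCompletion K))) {n' : ℤ}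
    (hGZ31 : (∀ (γ : 𝒢), ∀ e ∈ E', γ • e ∈ E') ∧ y ∈ E' ∧
      (∀ ℓ ∈ L, grAct A₀ (traceElt (σ ℓ) ℓ) y ∈ E'.map (zsmulAddGroupHom n : A₀ →+ A₀)) ∧
      ∀ x ∈ E', n' • pointsMap W (v.adicCompletion K) (j x) ∈ B)
    (hcop : IsCoprime n n')
    (hvanish : ∀ c : contOneCocycles (discreteTopRep (absoluteGaloisGroup (v.adicCompletion K))
        (localPoints W (v.adicCompletion K))),
      (∀ τ, c.1 τ ∈ B) → (∀ τ ∈ 𝔐.inertia (absoluteGaloisGroup (v.adicCompletion K)), c.1 τ = 0) →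
        oneCocycleClass _ c = 0) :
    kolyvaginClass W n hdiv hA (j (kolyvaginPoint σ L f y)) hP ∈
      selmerLocalKer W (v.adicCompletion K) n := by
  obtain ⟨hE, hy, htr, hloc⟩ := hGZ31
  -- integrality of the roots inside `E′` (p253535), transported along `j` (§1)
  have hroot : ∀ γ : 𝒢, γ • kolyvaginPoint σ L f y - kolyvaginPoint σ L f y ∈
      E'.map (zsmulAddGroupHom n : A₀ →+ A₀) :=
    smul_kolyvaginPoint_sub_mem_map hE hf hgen hord hdvd hy htr
  refine kolyvaginClass_mem_selmerLocalKer_of_inertia_of_mem_of_zsmul_mem W hA hP v hI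
    ((E'.map j).map (pointsMap W (v.adicCompletion K))) B hcop ?_ ?_ hvanish
  · -- `n′ • (j E′)_v ⊆ B`
    rintro _ ⟨_, ⟨x, hx, rfl⟩, rfl⟩
    exact hloc x hx
  · -- the values of McCallum's cocycle lie in `(j E′)_v`
    intro τ
    refine ⟨rootIn j.range n (resGal (K := K) (v.adicCompletion K) τ • j (kolyvaginPoint σ L f y) -
      j (kolyvaginPoint σ L f y)), ?_, rfl⟩
    exact rootIn_smul_sub_mem_map_of_equivariant π j hj hA hroot _

end End

end Summit.BirchSwinnertonDyer.Rank1Residual.X11b.Three.GrossBadPlace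

end
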